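import Literature.Probability.Percolation.SlabRSWGluingInterleave
import Literature.Probability.Percolation.SlabRSWProp39Iter
import Literature.Probability.Percolation.SlabCriticalityInputs
import HarnessLib

/-!
# Newman–Tassion–Wu 2017, §3.5 — Theorem 3.14, Case 1: the ladder of gluings along one side

Topic: `Literature/Probability/Percolation`. The first case of the proof of NTW's RSW Theorem 3.14
(positive-probability version, arXiv:1512.09107 pp. 16–17): if two segments `Z_i`, `Z_j`
(`Z_m = {7n} × [mn, (m+1)n)`) of the right side of `R = [-7n,7n] × [0,13n]` are joined inside `R`
with probability `≥ c`, then — gluing inside `R₁ = [-7n,7n] × [0,40n]` with GL0 (Thm. 3.6) in the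
configuration `A = Z_i`, `B = Z_{m-1}`, `C = Z_m`, `D = Z_{m-g}` (interleaved on one side, the
tree's `glueLinear_seg` of `SlabRSWGluingSegment.lean` with the planar fact
`planarCrossing_interleaved` of `SlabRSWGluingInterleave.lean`), translation invariance and
induction ((3.41)–(3.43)) — `Z_i` is joined to `Z_32` inside `R₁` with probability
`≥ c (c / (1 + λ^s))^{32-j}`, and then the rectangle `[-7n,7n] × [4n,32n]` is crossed from bottom
to top ((3.44): `f(28n, 14n) ≥ c₅`). Everything here is in the LINEAR regime of GL0
(`h₀(x) = x / (1 + λ^s)`, `λ = 2 / min(p, 1-p)`, `s = 3(5k+4)(12ρ+13)²`), which is all Case 1 uses.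

* `slabConn_bt_of_through`, `real_le_real_bt_of_through` — a path inside `[a,b] × [c,d]` from
  below the row `r₁` to above the row `r₂ ≥ r₁` contains a bottom-top crossing of `[a,b] × [r₁,r₂]`.
* `PlanarCrossing.reverse_right` — the planar-crossing hypothesis with the second pair reversed.
* `ladder` — THE LADDER: in `S = [a,b] × [c,d]` with the segments
  `Z_j = {b} × [c + jn, c + (j+1)n - 1]` of its right side, if `P_p[Z_{i₀+t} ⟷^S Z_{i₀+g+t}] ≥ c₀`
  for all `t` with `i₀ + g + t ≤ N` (`g ≥ 2`), then `P_p[Z_{i₀} ⟷^S Z_{i₀+g+t}] ≥ c₀ (c₀/(1+λ^s))^t`.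
* `real_seg_shift_le` — translation of a two-segment connection up the side, into a larger box
  (the tree's `image_planarShift_sideSeg`, `image_planarShift_boxR`, `real_slabConn_image`).
* **`case1_bt`**, **`case1_lr`** — NTW's Case 1: for `k ≥ 1`, `ρ ≥ 4`, `n ≥ 2ρ + 4`, `0 < p < 1`,
  `0 ≤ i ≤ 3`, `5 ≤ j ≤ 12`: `c₁ ≤ P_p[Z_i ⟷^R Z_j]` implies
  `c₁ (c₁/(1+λ^s))^{32-j} ≤ P_p[B ⟷ T in [-7n,7n] × [4n,32n]] = P_p[L ⟷ R in [0,28n] × [0,14n]]`.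

## Sources

* C. M. Newman, V. Tassion, W. Wu, *Critical percolation and the minimal spanning tree in slabs*,
  Comm. Pure Appl. Math. 70 (2017) 2084–2120, arXiv:1512.09107: §3.5, proof of Theorem 3.14,
  Case 1 ((3.40)–(3.44)); §3.2 Theorem 3.6 with Remark 3 [NewmanTassionWu2017].
-/

noncomputable section

namespace Literature.Probability.Percolation

open MeasureTheory LatticeModels SimpleGraph

namespace NTW17

variable {k : ℕ}

/-! ## §1 A path through a horizontal strip crosses it from bottom to top -/

/-- **Through-crossing** (lattice configurations): an `ω`-open path inside `[a,b] × [c,d]` from a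
set `X` lying on or below the row `r₁` to a set `Y` lying on or above the row `r₂ ≥ r₁` contains —
between its last visit of height `≤ r₁` before its first visit of height `≥ r₂`, and that visit —
an `ω`-open path inside `[a,b] × [r₁,r₂]` from the row `r₁` to the row `r₂`.
[cite: NewmanTassionWu2017, §3.5 (proof of Theorem 3.14, Case 1: "the rectangle [-7n,7n]×[4n,32n] is crossed from top to bottom")] -/
theorem slabConn_bt_of_through {a b c d r₁ r₂ : ℤ} (hr : r₁ ≤ r₂) {X Y : Set (ℤ × ℤ)}
    (hX : ∀ z ∈ X, z.2 ≤ r₁) (hY : ∀ z ∈ Y, r₂ ≤ z.2)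
    {ω : BondConfig (slab 3 k)} (hω : ω ⊆ (slabGraph 3 k).edgeSet)
    (h : ω ∈ slabConn k (boxR a b c d) X Y) :
    ω ∈ slabConn k (boxR a b r₁ r₂) {z | z.2 = r₁} {z | z.2 = r₂} := by
  obtain ⟨l, hl⟩ := (mem_slabConn_iff_exists_isOSAP ω _ _ _).1 h
  have hcol : ∀ v ∈ l, a ≤ (planar k v).1 ∧ (planar k v).1 ≤ b := by
    intro v hv; have := hl.subset v hv; rw [mem_slabLift_iff, mem_boxR_iff] at this
    exact ⟨this.1, this.2.1⟩
  have hch := isChain_adj_of_isChain_open hω hl.chain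
  -- one step changes the height by at most one
  have hstep : ∀ {m₁ m₂ : List (slab 3 k)} (h₁ : m₁ ≠ []) (h₂ : m₂ ≠ []), l = m₁ ++ m₂ →
      (planar k (m₂.head h₂)).2 ≤ (planar k (m₁.getLast h₁)).2 + 1 ∧
        (planar k (m₁.getLast h₁)).2 ≤ (planar k (m₂.head h₂)).2 + 1 := by
    intro m₁ m₂ h₁ h₂ heq
    have hch' := hch
    rw [heq] at hch'
    have h1 := planar_mem_sqBox_one_of_adj (hch'.rel_getLast_head_of_append h₁ h₂)
    rw [mem_sqBox_iff'] at h1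
    push_cast at h1
    omega
  have hhead : (planar k (l.head hl.ne_nil)).2 ≤ r₁ := by
    have := hl.head_mem hl.ne_nil; rw [mem_slabLift_iff] at this; exact hX _ this
  -- the first vertex `v` of height `≥ r₂`
  obtain ⟨p₀, v, rest, hleq, hv, hp₀⟩ := exists_first_split (p := fun u => r₂ ≤ (planar k u).2) l
    ⟨l.getLast hl.ne_nil, List.getLast_mem _,
      hY _ (by have := hl.last_mem hl.ne_nil; rwa [mem_slabLift_iff] at this)⟩
  simp only [not_le] at hp₀
  have hv2 : (planar k v).2 = r₂ := by
    by_cases hp : p₀ = []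
    · subst hp
      have hh : l.head hl.ne_nil = v := by
        have key : ∀ (m : List (slab 3 k)) (hm : m ≠ []), m = [] ++ v :: rest → m.head hm = v := by
          intro m hm hmeq; subst hmeq; rfl
        exact key l hl.ne_nil hleq
      rw [hh] at hhead
      omega
    · have := (hstep hp (List.cons_ne_nil v rest) hleq).1
      simp only [List.head_cons] at this
      have := hp₀ _ (List.getLast_mem hp)
      omega
  -- the prefix `p₀ ++ [v]` up to `v`, and its last vertex `u` of height `≤ r₁`
  have hl₁ne : p₀ ++ [v] ≠ [] := by simp
  have hleq' : l = (p₀ ++ [v]) ++ rest := by rw [hleq, List.append_assoc]; rfl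
  have hheadl₁ : (p₀ ++ [v]).head hl₁ne = l.head hl.ne_nil := by
    have key : ∀ (m : List (slab 3 k)) (hm : m ≠ []), m = p₀ ++ v :: rest →
        (p₀ ++ [v]).head hl₁ne = m.head hm := by
      intro m hm hmeq; subst hmeq; cases p₀ <;> simp
    exact key l hl.ne_nil hleq
  obtain ⟨q₁, u, q₂, hl₁eq, hu, hq₂⟩ := exists_last_split (p := fun w => (planar k w).2 ≤ r₁) (p₀ ++ [v])
    ⟨(p₀ ++ [v]).head hl₁ne, List.head_mem _, by rw [hheadl₁]; exact hhead⟩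
  simp only [not_le] at hq₂
  have hlastl₁ : (p₀ ++ [v]).getLast hl₁ne = v := by simp
  -- `l = q₁ ++ (u :: q₂) ++ rest`
  have hleq'' : l = q₁ ++ ((u :: q₂) ++ rest) := by rw [hleq', hl₁eq, List.append_assoc]
  -- heights along `u :: q₂`
  have hq₂l₁ : ∀ y ∈ q₂, y ∈ p₀ ++ [v] := fun y hy => by rw [hl₁eq]; simp [hy]
  have hle_r₂ : ∀ y ∈ p₀ ++ [v], (planar k y).2 ≤ r₂ := by
    intro y hy
    rcases List.mem_append.1 hy with hy | hy
    · exact (hp₀ y hy).le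
    · rw [List.mem_singleton.1 hy, hv2]
  have hul₁ : u ∈ p₀ ++ [v] := by rw [hl₁eq]; simp
  have hu2 : (planar k u).2 = r₁ := by
    by_cases hq : q₂ = []
    · -- `u` is the last vertex of `p₀ ++ [v]`, i.e. `v`
      have huv : u = v := by
        rw [← hlastl₁, List.getLast_congr _ (by simp) hl₁eq]
        simp [hq]
      rw [huv, hv2] at hu ⊢
      omega
    · have hq₁u : q₁ ++ [u] ≠ [] := by simp
      have heq3 : l = (q₁ ++ [u]) ++ (q₂ ++ rest) := by rw [hleq'']; simp
      have hq₂r : q₂ ++ rest ≠ [] := by simp [hq]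
      have h1 := (hstep hq₁u hq₂r heq3).1
      rw [List.getLast_append_of_ne_nil _ (by simp), List.getLast_singleton,
        List.head_append_of_ne_nil hq] at h1
      have h2 := hq₂ _ (List.head_mem hq)
      omega
  -- the segment `u :: q₂` is an open self-avoiding path inside `[a,b] × [r₁,r₂]` from row `r₁` to row `r₂`
  have hseg : IsOSAP k ω (slabLift k (boxR a b r₁ r₂)) (slabLift k {z | z.2 = r₁}) (slabLift k {z | z.2 = r₂})
      (u :: q₂) := by
    refine ⟨?_, ?_, ?_, List.cons_ne_nil u q₂, ?_, ?_⟩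
    · have := hl.nodup; rw [hleq''] at this
      exact this.sublist ((List.infix_append q₁ (u :: q₂) rest).sublist.trans (by simp))
    · have := hl.chain; rw [hleq''] at this
      exact this.right_of_append.left_of_append
    · intro x hx
      rw [mem_slabLift_iff, mem_boxR_iff]
      have hxl : x ∈ l := by rw [hleq'']; simp only [List.mem_append, List.mem_cons] at hx ⊢; tauto
      obtain ⟨h1, h2⟩ := hcol x hxl
      rcases List.mem_cons.1 hx with rfl | hx
      · exact ⟨h1, h2, hu2.ge, hle_r₂ _ hul₁⟩
      · exact ⟨h1, h2, (hq₂ x hx).le, hle_r₂ x (hq₂l₁ x hx)⟩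
    · intro _; simpa using hu2
    · intro hne
      rw [mem_slabLift_iff, Set.mem_setOf_eq]
      have : (u :: q₂).getLast hne = v := by
        rw [← hlastl₁, List.getLast_congr _ (by simp) hl₁eq]
        simp
      rw [this, hv2]
  exact (mem_slabConn_iff_exists_isOSAP ω _ _ _).2 ⟨_, hseg⟩

/-- **Through-crossing, in probability**: `P_p[X ⟷^{[a,b]×[c,d]} Y] ≤ P_p[B ⟷ T in [a,b] × [r₁,r₂]]`
for `X` on or below the row `r₁`, `Y` on or above the row `r₂ ≥ r₁`.
[cite: NewmanTassionWu2017, §3.5 (proof of Theorem 3.14, Case 1, (3.44))] -/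
theorem real_le_real_bt_of_through {a b c d r₁ r₂ : ℤ} (hr : r₁ ≤ r₂) {X Y : Set (ℤ × ℤ)}
    (hX : ∀ z ∈ X, z.2 ≤ r₁) (hY : ∀ z ∈ Y, r₂ ≤ z.2) (p : unitInterval) :
    (bondPercolation (slabGraph 3 k) p).real (slabConn k (boxR a b c d) X Y) ≤
      (bondPercolation (slabGraph 3 k) p).real (slabConn k (boxR a b r₁ r₂) {z | z.2 = r₁} {z | z.2 = r₂}) := by
  set P := bondPercolation (slabGraph 3 k) p
  have hae : ∀ᵐ ω ∂P, ω ∈ slabConn k (boxR a b c d) X Y →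
      ω ∈ slabConn k (boxR a b r₁ r₂) {z | z.2 = r₁} {z | z.2 = r₂} := by
    filter_upwards [ae_subset_edgeSet (slabGraph 3 k) p] with ω hω h
    exact slabConn_bt_of_through hr hX hY hω h
  simp only [measureReal_def]
  exact ENNReal.toReal_mono (measure_ne_top _ _) (measure_mono_ae hae)

/-! ## §2 The planar-crossing hypothesis with one pair reversed -/

/-- Reversing the second path in NTW's planar-crossing hypothesis.
[cite: NewmanTassionWu2017, §3.2 (Theorem 3.6, hypothesis on A, B, C, D)] -/
theorem PlanarCrossing.reverse_right {S A B C D : Set (ℤ × ℤ)} (h : PlanarCrossing S A B C D) :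
    PlanarCrossing S A B D C := by
  intro l₁ l₂ h₁ h₂ hw₁ hw₂ hS₁ hS₂ hhA hlB hhD hlC
  have hr₂ : l₂.reverse ≠ [] := by simpa using h₂
  have hw₂' : IsPlanarWalk l₂.reverse := by
    rw [IsPlanarWalk, List.isChain_reverse]
    refine List.IsChain.imp (fun x y hxy => ?_) hw₂
    rcases hxy with hxy | hxy
    · exact Or.inl hxy.symm
    · exact Or.inr (planarAdj_symm hxy)
  obtain ⟨z, hz₁, hz₂⟩ := h l₁ l₂.reverse h₁ hr₂ hw₁ hw₂' hS₁
    (fun z hz => hS₂ z (List.mem_reverse.1 hz)) hhA hlB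
    (by rw [List.head_reverse]; exact hlC) (by rw [List.getLast_reverse]; exact hhD)
  exact ⟨z, hz₁, List.mem_reverse.1 hz₂⟩

/-! ## §3 The ladder -/

/-- Membership in a side segment. [cite: NewmanTassionWu2017, §3.5 (the segments Z_i)] -/
theorem mem_sideSeg_iff' {x s t : ℤ} {z : ℤ × ℤ} : z ∈ sideSeg x s t ↔ z.1 = x ∧ s ≤ z.2 ∧ z.2 ≤ t :=
  Iff.rfl

/-- **THE LADDER OF GLUINGS ALONG ONE SIDE** (NTW's induction (3.41)–(3.43), linear regime).  In
`S = [a,b] × [c,d]` (slab `S_k`, `k ≥ 1`), let `Z_j = {b} × [c + jn, c + (j+1)n - 1]` (`n ≥ 2ρ+4`,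
`ρ ≥ 4`) and `g ≥ 2`.  If `c₀ ≤ P_p[Z_{i₀+t} ⟷^S Z_{i₀+g+t}]` for every `t` with `i₀+g+t ≤ N`
(segments up to `Z_N` inside `S`), then for every such `t`,
`c₀ · (c₀ / (1+λ^s))^t ≤ P_p[Z_{i₀} ⟷^S Z_{i₀+g+t}]` (`λ = 2/min(p,1-p)`, `s = 3(5k+4)(12ρ+13)²`):
GL0 (`glueLinear_seg`) with `A = Z_{i₀}`, `B = Z_{i₀+g+t}`, `C = Z_{i₀+g+t+1}`, `D = Z_{i₀+t+1}`,
interleaved on the right side. [cite: NewmanTassionWu2017, §3.5 (proof of Theorem 3.14, Case 1, (3.41)–(3.43))] -/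
theorem ladder (hk : 1 ≤ k) {ρ : ℕ} (hρ : 4 ≤ ρ) {a b c d : ℤ} (hab : a + 3 ≤ b) (hcd : c + 3 ≤ d)
    {n : ℕ} (hn : 2 * ρ + 4 ≤ n) (Z : ℕ → Set (ℤ × ℤ))
    (hZ : ∀ j : ℕ, Z j = sideSeg b (c + j * n) (c + j * n + n - 1))
    {i₀ g N : ℕ} (hg : 2 ≤ g) (hN : c + N * n + n - 1 ≤ d)
    (p : unitInterval) (hp0 : 0 < (p : ℝ)) (hp1 : (p : ℝ) < 1) {c₀ : ℝ} (hc₀ : 0 ≤ c₀)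
    (hyp : ∀ t : ℕ, i₀ + g + t ≤ N → c₀ ≤ (bondPercolation (slabGraph 3 k) p).real
      (slabConn k (boxR a b c d) (Z (i₀ + t)) (Z (i₀ + g + t)))) :
    ∀ t : ℕ, i₀ + g + t ≤ N →
      c₀ * (c₀ / (1 + (2 / min (p : ℝ) (1 - p)) ^ (3 * ((5 * k + 4) * (2 * (2 * (3 * ρ + 3)) + 1) ^ 2)))) ^ t ≤
        (bondPercolation (slabGraph 3 k) p).real (slabConn k (boxR a b c d) (Z i₀) (Z (i₀ + g + t))) := by
  set P := bondPercolation (slabGraph 3 k) p with hP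
  set Λ : ℝ := 1 + (2 / min (p : ℝ) (1 - p)) ^ (3 * ((5 * k + 4) * (2 * (2 * (3 * ρ + 3)) + 1) ^ 2)) with hΛ
  have hΛpos : 0 < Λ := by positivity
  have hn0 : (0 : ℤ) ≤ n := by positivity
  intro t
  induction t with
  | zero =>
    intro h0
    simpa using hyp 0 h0
  | succ t ih =>
    intro ht
    have ih' := ih (by omega)
    have hy := hyp (t + 1) ht
    -- heights of the four segments
    have hmono : ∀ {u v : ℕ}, u ≤ v → (u : ℤ) * n ≤ (v : ℤ) * n := fun huv =>
      mul_le_mul_of_nonneg_right (by exact_mod_cast huv) hn0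
    -- the gluing setting
    let V : SegSetup :=
      { a := a, b := b, c := c, d := d
        y₁ := c + (i₀ + g + t : ℕ) * n, y₂ := c + (i₀ + g + t : ℕ) * n + n - 1
        A := Z i₀, C := Z (i₀ + g + (t + 1))
        hab := hab, hcd := hcd
        hy₁ := by have := hmono (Nat.zero_le (i₀ + g + t)); push_cast at this ⊢; linarith
        hy := by have : (2 * ρ + 4 : ℤ) ≤ n := by exact_mod_cast hn
                 linarith
        hy₂ := by have := hmono (show i₀ + g + t ≤ N by omega); linarith
        hA := by
          intro z hz; rw [hZ, mem_sideSeg_iff'] at hz; rw [mem_boxR_iff]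
          have h1 := hmono (Nat.zero_le i₀); have h2 := hmono (show i₀ ≤ N by omega)
          push_cast at h1 h2 hz; omega
        hC := by
          intro z hz; rw [hZ, mem_sideSeg_iff'] at hz; rw [mem_boxR_iff]
          have h1 := hmono (Nat.zero_le (i₀ + g + (t + 1))); have h2 := hmono ht
          push_cast at h1 h2 hz; omega }
    have hS : V.S = boxR a b c d := rfl
    have hB : V.B = Z (i₀ + g + t) := by rw [hZ]; rfl
    -- separation of `A = Z_{i₀}` and `C = Z_{i₀+g+t+1}`: heights differ by more than `2n ≥ 4ρ + 8`
    have hsep : ∀ a' ∈ V.A, ∀ c' ∈ V.C, c' ∉ sqBox a' (4 * ρ + 8) := by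
      intro a' ha' c' hc' hmem
      change a' ∈ Z i₀ at ha'; change c' ∈ Z (i₀ + g + (t + 1)) at hc'
      rw [hZ, mem_sideSeg_iff'] at ha' hc'
      rw [mem_sqBox_iff'] at hmem
      have h1 := hmono (show i₀ + 3 ≤ i₀ + g + (t + 1) by omega)
      have h2 : (2 * ρ + 4 : ℤ) ≤ n := by exact_mod_cast hn
      push_cast at h1 ha' hc' hmem
      nlinarith
    -- the planar-crossing hypothesis: `Z_{i₀} < Z_{i₀+t+1} < Z_{i₀+g+t} = B < Z_{i₀+g+t+1}` on the right side
    have hcross : PlanarCrossing V.S V.A V.B V.C (Z (i₀ + (t + 1))) := by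
      rw [hS, hB]
      change PlanarCrossing (boxR a b c d) (Z i₀) (Z (i₀ + g + t)) (Z (i₀ + g + (t + 1))) (Z (i₀ + (t + 1)))
      refine (planarCrossing_interleaved (a := a) (b := b) (c := c) (d := d)
        (t₁ := c + (i₀ + (t + 1) : ℕ) * n) (t₂ := c + (i₀ + g + t : ℕ) * n)
        (t₃ := c + (i₀ + g + t : ℕ) * n + n) ?_ ?_ ?_ ?_).reverse_right
      · intro z hz; rw [hZ, mem_sideSeg_iff'] at hz
        have h1 := hmono (show i₀ + 1 ≤ i₀ + (t + 1) by omega)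
        push_cast at h1 hz ⊢; constructor <;> [exact hz.1; linarith]
      · intro z hz; rw [hZ, mem_sideSeg_iff'] at hz
        have h1 := hmono (show i₀ + (t + 1) + 1 ≤ i₀ + g + t by omega)
        push_cast at h1 hz ⊢
        exact ⟨hz.1, hz.2.1, by linarith⟩
      · intro z hz; rw [hZ, mem_sideSeg_iff'] at hz
        push_cast at hz ⊢
        exact ⟨hz.1, hz.2.1, by linarith⟩
      · intro z hz; rw [hZ, mem_sideSeg_iff'] at hz
        push_cast at hz ⊢
        exact ⟨hz.1, by linarith⟩
    -- GL0, linear regime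
    have hgl := glueLinear_seg V hk hρ hsep hcross p hp0 hp1
    rw [hS, hB] at hgl
    change P.real (slabConn k (boxR a b c d) (Z i₀) (Z (i₀ + g + t))) *
        P.real (slabConn k (boxR a b c d) (Z (i₀ + g + (t + 1))) (Z (i₀ + (t + 1)))) ≤
      Λ * P.real (slabConn k (boxR a b c d) (Z (i₀ + g + (t + 1))) (Z i₀)) at hgl
    rw [_root_.Literature.Probability.Percolation.slabConn_comm k (boxR a b c d) (Z (i₀ + g + (t + 1))) (Z i₀),
      _root_.Literature.Probability.Percolation.slabConn_comm k (boxR a b c d) (Z (i₀ + g + (t + 1)))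
        (Z (i₀ + (t + 1)))] at hgl
    have hy' : c₀ ≤ P.real (slabConn k (boxR a b c d) (Z (i₀ + (t + 1))) (Z (i₀ + g + (t + 1)))) := by
      have e1 : i₀ + (t + 1) = i₀ + t + 1 := by ring
      have e2 : i₀ + g + (t + 1) = i₀ + g + t + 1 := by ring
      rw [e1, e2]; exact hy
    -- arithmetic
    have hprod : c₀ * (c₀ / Λ) ^ t * c₀ ≤
        Λ * P.real (slabConn k (boxR a b c d) (Z i₀) (Z (i₀ + g + (t + 1)))) :=
      (mul_le_mul ih' hy' hc₀ measureReal_nonneg).trans hgl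
    rw [pow_succ, ← mul_assoc, ← mul_div_assoc, div_le_iff₀ hΛpos]
    calc c₀ * (c₀ / Λ) ^ t * c₀ ≤ Λ * P.real (slabConn k (boxR a b c d) (Z i₀) (Z (i₀ + g + (t + 1)))) := hprod
      _ = _ := mul_comm _ _

/-! ## §4 Translation up the side, and NTW's Case 1 -/

/-- **Translation up the side, into a taller box**: with `Z_j = {b} × [c + jn, c + (j+1)n - 1]`,
`P_p[Z_i ⟷^{[a,b]×[c,d]} Z_j] ≤ P_p[Z_{i+t} ⟷^{[a,b]×[c,d']} Z_{j+t}]` whenever `d + tn ≤ d'`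
(shift by `(0, tn)`, then enlarge the domain).
[cite: NewmanTassionWu2017, §3.5 (proof of Theorem 3.14, Case 1, (3.42): "translation invariance")] -/
theorem real_seg_shift_le {a b c d d' : ℤ} {n : ℕ} (Z : ℕ → Set (ℤ × ℤ))
    (hZ : ∀ j : ℕ, Z j = sideSeg b (c + j * n) (c + j * n + n - 1)) (i j t : ℕ)
    (hd : d + t * n ≤ d') (p : unitInterval) :
    (bondPercolation (slabGraph 3 k) p).real (slabConn k (boxR a b c d) (Z i) (Z j)) ≤
      (bondPercolation (slabGraph 3 k) p).real (slabConn k (boxR a b c d') (Z (i + t)) (Z (j + t))) := by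
  set v : ℤ × ℤ := (0, (t : ℤ) * n) with hv
  have hn0 : (0 : ℤ) ≤ (t : ℤ) * n := by positivity
  have hR : planarShift v '' boxR a b c d = boxR a b (c + t * n) (d + t * n) := by
    rw [image_planarShift_boxR]; simp [hv]
  have hZi : ∀ m : ℕ, planarShift v '' Z m = Z (m + t) := by
    intro m
    rw [hZ, hZ, image_planarShift_sideSeg]
    simp only [hv, add_zero]
    push_cast
    congr 1 <;> ring
  calc (bondPercolation (slabGraph 3 k) p).real (slabConn k (boxR a b c d) (Z i) (Z j))
      = (bondPercolation (slabGraph 3 k) p).real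
          (slabConn k (planarShift v '' boxR a b c d) (planarShift v '' Z i) (planarShift v '' Z j)) :=
        (real_slabConn_image k (planarShift v) (planarAdj_planarShift v) p _ _ _).symm
    _ = (bondPercolation (slabGraph 3 k) p).real
          (slabConn k (boxR a b (c + t * n) (d + t * n)) (Z (i + t)) (Z (j + t))) := by rw [hR, hZi, hZi]
    _ ≤ _ := by
        refine measureReal_mono (slabConn_mono_domain fun z hz => ?_)
        rw [mem_boxR_iff] at hz ⊢
        omega

/-- **NTW 2017, THEOREM 3.14, CASE 1** (bottom-top form).  Slab `S_k` (`k ≥ 1`), `ρ ≥ 4`,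
`n ≥ 2ρ + 4`, `0 < p < 1`; `R = [-7n,7n] × [0,13n]`, `Z_m = {7n} × [mn, (m+1)n - 1]`
(`X = Z_0 ∪ ⋯ ∪ Z_3`, `Y = Z_5 ∪ ⋯ ∪ Z_12`).  If `c₁ ≤ P_p[Z_i ⟷^R Z_j]` for some `i ≤ 3` and
`5 ≤ j ≤ 12`, then the rectangle `[-7n,7n] × [4n,32n]` is crossed from bottom to top with
probability at least `c₁ · (c₁ / (1+λ^s))^{32-j}` (`λ = 2/min(p,1-p)`, `s = 3(5k+4)(12ρ+13)²`):
the ladder inside `R₁ = [-7n,7n] × [0,40n]` reaches `Z_32`.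
[cite: NewmanTassionWu2017, §3.5 (proof of Theorem 3.14, Case 1, (3.40)–(3.44))] -/
theorem case1_bt (hk : 1 ≤ k) {ρ : ℕ} (hρ : 4 ≤ ρ) {n : ℕ} (hn : 2 * ρ + 4 ≤ n)
    (p : unitInterval) (hp0 : 0 < (p : ℝ)) (hp1 : (p : ℝ) < 1) {c₁ : ℝ} (hc₁ : 0 ≤ c₁)
    {i j : ℕ} (hi : i ≤ 3) (hj : 5 ≤ j) (hj' : j ≤ 12)
    (h : c₁ ≤ (bondPercolation (slabGraph 3 k) p).real (slabConn k (boxR (-(7 * n)) (7 * n) 0 (13 * n))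
      (sideSeg (7 * n) (i * n) (i * n + n - 1)) (sideSeg (7 * n) (j * n) (j * n + n - 1)))) :
    c₁ * (c₁ / (1 + (2 / min (p : ℝ) (1 - p)) ^ (3 * ((5 * k + 4) * (2 * (2 * (3 * ρ + 3)) + 1) ^ 2)))) ^ (32 - j) ≤
      (bondPercolation (slabGraph 3 k) p).real
        (slabConn k (boxR (-(7 * n)) (7 * n) (4 * n) (32 * n)) {z | z.2 = 4 * n} {z | z.2 = 32 * n}) := by
  set P := bondPercolation (slabGraph 3 k) p with hP
  have hn0 : (0 : ℤ) ≤ n := by positivity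
  have hn1 : (12 : ℤ) ≤ n := by
    have : 12 ≤ n := by omega
    exact_mod_cast this
  set Z : ℕ → Set (ℤ × ℤ) := fun m => sideSeg (7 * n) ((m : ℤ) * n) ((m : ℤ) * n + n - 1) with hZdef
  have hZ : ∀ m : ℕ, Z m = sideSeg (7 * n) (0 + m * n) (0 + m * n + n - 1) := by
    intro m; simp only [hZdef, zero_add]
  have hmono : ∀ {u v : ℕ}, u ≤ v → (u : ℤ) * n ≤ (v : ℤ) * n := fun huv =>
    mul_le_mul_of_nonneg_right (by exact_mod_cast huv) hn0
  -- the hypothesis, translated up the side of `R₁ = [-7n,7n] × [0,40n]`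
  have hyp : ∀ t : ℕ, i + (j - i) + t ≤ 32 → c₁ ≤ P.real
      (slabConn k (boxR (-(7 * n)) (7 * n) 0 (40 * n)) (Z (i + t)) (Z (i + (j - i) + t))) := by
    intro t ht
    have hij : i + (j - i) = j := by omega
    rw [hij]
    refine h.trans ?_
    have h1 := hmono (show 13 + t ≤ 40 by omega)
    exact real_seg_shift_le Z hZ i j t (by push_cast at h1 ⊢; linarith) p
  have hlad := ladder hk hρ (a := -(7 * n)) (b := 7 * n) (c := 0) (d := 40 * n) (by omega) (by omega)
    hn Z hZ (i₀ := i) (g := j - i) (N := 32) (by omega) (by push_cast; omega) p hp0 hp1 hc₁ hyp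
    (32 - j) (by omega)
  have h32 : i + (j - i) + (32 - j) = 32 := by omega
  rw [h32] at hlad
  refine hlad.trans (real_le_real_bt_of_through (by linarith) (fun z hz => ?_) (fun z hz => ?_) p)
  · rw [hZdef, mem_sideSeg_iff'] at hz
    have h1 := hmono (show i + 1 ≤ 4 by omega)
    push_cast at h1 hz
    linarith
  · rw [hZdef, mem_sideSeg_iff'] at hz
    push_cast at hz
    linarith

/-- **NTW 2017, THEOREM 3.14, CASE 1** (the form (3.44): `f(28n, 14n) ≥ c₅`): under the hypotheses
of `case1_bt`, `c₁ · (c₁/(1+λ^s))^{32-j} ≤ P_p[L ⟷ R in [0,28n] × [0,14n]]`.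
[cite: NewmanTassionWu2017, §3.5 (proof of Theorem 3.14, Case 1, (3.44))] -/
theorem case1_lr (hk : 1 ≤ k) {ρ : ℕ} (hρ : 4 ≤ ρ) {n : ℕ} (hn : 2 * ρ + 4 ≤ n)
    (p : unitInterval) (hp0 : 0 < (p : ℝ)) (hp1 : (p : ℝ) < 1) {c₁ : ℝ} (hc₁ : 0 ≤ c₁)
    {i j : ℕ} (hi : i ≤ 3) (hj : 5 ≤ j) (hj' : j ≤ 12)
    (h : c₁ ≤ (bondPercolation (slabGraph 3 k) p).real (slabConn k (boxR (-(7 * n)) (7 * n) 0 (13 * n))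
      (sideSeg (7 * n) (i * n) (i * n + n - 1)) (sideSeg (7 * n) (j * n) (j * n + n - 1)))) :
    c₁ * (c₁ / (1 + (2 / min (p : ℝ) (1 - p)) ^ (3 * ((5 * k + 4) * (2 * (2 * (3 * ρ + 3)) + 1) ^ 2)))) ^ (32 - j) ≤
      (bondPercolation (slabGraph 3 k) p).real
        (slabConn k (boxR 0 (28 * n) 0 (14 * n)) {z | z.1 = 0} {z | z.1 = 28 * n}) := by
  have h1 := case1_bt hk hρ hn p hp0 hp1 hc₁ hi hj hj' h
  rw [real_bt_eq_lr] at h1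
  have h2 := real_lr_shift (k := k) (((4 : ℤ) * n, -(7 * (n : ℤ)))) 0 (28 * n) 0 (14 * n) p
  dsimp only at h2
  have e2 : (28 : ℤ) * n + 4 * n = 32 * n := by ring
  have e4 : (14 : ℤ) * n + -(7 * (n : ℤ)) = 7 * n := by ring
  rw [zero_add, zero_add, e2, e4] at h2
  rw [← h2]
  exact h1

/-! ## §5 Case 1 from the event `𝓑₁ = {Y ⟷^R X}` -/

/-- The index of the segment `Z_q = {b} × [qn, (q+1)n - 1]` containing a point of height
`t ∈ [0, Mn - 1]`: `q = ⌊t/n⌋ ∈ [0, M-1]`. [cite: NewmanTassionWu2017, §3.5 (proof of Theorem 3.14, Case 1: "X = Z_0 ∪ ⋯ ∪ Z_3 and Y = Z_5 ∪ ⋯ ∪ Z_12")] -/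
theorem exists_seg_index {n : ℕ} (hn : 1 ≤ n) {t : ℤ} (ht : 0 ≤ t) {M : ℕ} (htM : t ≤ (M : ℤ) * n - 1) :
    ∃ q : ℕ, q < M ∧ (q : ℤ) * n ≤ t ∧ t ≤ (q : ℤ) * n + n - 1 := by
  have hn0 : (0 : ℤ) < n := by exact_mod_cast hn
  have h1 := Int.emod_add_mul_ediv t n
  have h2 := Int.emod_nonneg t hn0.ne'
  have h3 := Int.emod_lt_of_pos t hn0
  have hq0 : 0 ≤ t / n := Int.ediv_nonneg ht hn0.le
  refine ⟨(t / n).toNat, ?_, ?_, ?_⟩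
  · have hlt : t / n < M := by
      by_contra hge
      push Not at hge
      have : (M : ℤ) * n ≤ n * (t / n) := by nlinarith
      omega
    have : ((t / n).toNat : ℤ) < M := by rw [Int.toNat_of_nonneg hq0]; exact hlt
    exact_mod_cast this
  · rw [Int.toNat_of_nonneg hq0]; linarith
  · rw [Int.toNat_of_nonneg hq0]; linarith

/-- **`𝓑₁` is covered by the `4 × 8` events `Z_i ⟷^R Z_j`** (`X = Z_0 ∪ ⋯ ∪ Z_3`, `Y = Z_5 ∪ ⋯ ∪ Z_12`).
[cite: NewmanTassionWu2017, §3.5 (proof of Theorem 3.14, Case 1, (3.40))] -/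
theorem B1_subset_iUnion {n : ℕ} (hn : 1 ≤ n) (R : Set (ℤ × ℤ)) :
    slabConn k R (sideSeg (7 * n) (5 * n) (13 * n - 1)) (sideSeg (7 * n) 0 (4 * n - 1)) ⊆
      ⋃ ij ∈ Finset.range 4 ×ˢ Finset.Icc 5 12,
        slabConn k R (sideSeg (7 * n) ((ij.1 : ℕ) * n) ((ij.1 : ℕ) * n + n - 1))
          (sideSeg (7 * n) ((ij.2 : ℕ) * n) ((ij.2 : ℕ) * n + n - 1)) := by
  rintro ω ⟨a, ha, b, hb, hconn⟩
  rw [mem_slabLift_iff, mem_sideSeg_iff'] at ha hb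
  obtain ⟨j, hj, hj1, hj2⟩ := exists_seg_index hn (t := (planar k a).2) (M := 13) (by
    have : (0 : ℤ) ≤ n := by positivity
    linarith [ha.2.1]) (by push_cast; linarith [ha.2.2])
  obtain ⟨i, hi, hi1, hi2⟩ := exists_seg_index hn (t := (planar k b).2) (M := 4) hb.2.1 (by push_cast; linarith [hb.2.2])
  have hj5 : 5 ≤ j := by
    by_contra hlt
    push Not at hlt
    have : (j : ℤ) + 1 ≤ 5 := by exact_mod_cast hlt
    have hn0 : (0 : ℤ) ≤ n := by positivity
    nlinarith [ha.2.1]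
  refine Set.mem_iUnion₂.2 ⟨(i, j), Finset.mem_product.2 ⟨Finset.mem_range.2 hi, Finset.mem_Icc.2 ⟨hj5, by omega⟩⟩, ?_⟩
  exact slabConn_comm ⟨a, by rw [mem_slabLift_iff, mem_sideSeg_iff']; exact ⟨ha.1, hj1, hj2⟩, b,
    by rw [mem_slabLift_iff, mem_sideSeg_iff']; exact ⟨hb.1, hi1, hi2⟩, hconn⟩

/-- **NTW 2017, THEOREM 3.14, CASE 1 — from `𝓑₁` to `f(28n,14n)`.**  Slab `S_k` (`k ≥ 1`), `ρ ≥ 4`,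
`n ≥ 2ρ + 4`, `0 < p < 1`; `R = [-7n,7n] × [0,13n-1]`, `X = {7n} × [0,4n-1]`, `Y = {7n} × [5n,13n-1]`
(the sets of `SlabRSWLemma315.lean`).  If `c ≤ P_p[𝓑₁] = P_p[Y ⟷^R X]`, then
`(c/32) · ((c/32)/(1+λ^s))^{27} ≤ f_p(28n, 14n)`: the union bound over the `32` pairs `(Z_i, Z_j)`
((3.40)), the ladder in `R₁ = [-7n,7n] × [0,40n]` (`case1_lr`), and monotonicity in the exponent.
[cite: NewmanTassionWu2017, §3.5 (proof of Theorem 3.14, Case 1, (3.40)–(3.44))] -/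
theorem case1_of_B1 (hk : 1 ≤ k) {ρ : ℕ} (hρ : 4 ≤ ρ) {n : ℕ} (hn : 2 * ρ + 4 ≤ n)
    (p : unitInterval) (hp0 : 0 < (p : ℝ)) (hp1 : (p : ℝ) < 1) {c : ℝ} (hc : 0 ≤ c)
    (h : c ≤ (bondPercolation (slabGraph 3 k) p).real (slabConn k (boxR (-(7 * n)) (7 * n) 0 (13 * n - 1))
      (sideSeg (7 * n) (5 * n) (13 * n - 1)) (sideSeg (7 * n) 0 (4 * n - 1)))) :
    c / 32 * (c / 32 / (1 + (2 / min (p : ℝ) (1 - p)) ^ (3 * ((5 * k + 4) * (2 * (2 * (3 * ρ + 3)) + 1) ^ 2)))) ^ 27 ≤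
      (bondPercolation (slabGraph 3 k) p).real
        (slabConn k (boxR 0 (28 * n) 0 (14 * n)) {z | z.1 = 0} {z | z.1 = 28 * n}) := by
  classical
  set P := bondPercolation (slabGraph 3 k) p with hP
  set Λ : ℝ := 1 + (2 / min (p : ℝ) (1 - p)) ^ (3 * ((5 * k + 4) * (2 * (2 * (3 * ρ + 3)) + 1) ^ 2)) with hΛ
  have hΛ1 : 1 ≤ Λ := le_add_of_nonneg_right (by positivity)
  clear_value Λ
  have hn1 : 1 ≤ n := by omega
  set E : ℕ × ℕ → Set (BondConfig (slab 3 k)) := fun ij =>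
    slabConn k (boxR (-(7 * n)) (7 * n) 0 (13 * n - 1)) (sideSeg (7 * n) ((ij.1 : ℕ) * n) ((ij.1 : ℕ) * n + n - 1))
      (sideSeg (7 * n) ((ij.2 : ℕ) * n) ((ij.2 : ℕ) * n + n - 1)) with hE
  set I : Finset (ℕ × ℕ) := Finset.range 4 ×ˢ Finset.Icc 5 12 with hI
  -- the union bound
  have hcard : I.card = 32 := by rw [hI, Finset.card_product, Finset.card_range, Nat.card_Icc]
  have hsum : ∑ ij ∈ I, (fun _ => c / 32) ij ≤ ∑ ij ∈ I, P.real (E ij) := by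
    calc ∑ ij ∈ I, (fun _ => c / 32) ij = c := by rw [Finset.sum_const, hcard]; simp; ring
      _ ≤ P.real (slabConn k (boxR (-(7 * n)) (7 * n) 0 (13 * n - 1))
            (sideSeg (7 * n) (5 * n) (13 * n - 1)) (sideSeg (7 * n) 0 (4 * n - 1))) := h
      _ ≤ P.real (⋃ ij ∈ I, E ij) := measureReal_mono (B1_subset_iUnion hn1 _) (measure_ne_top _ _)
      _ ≤ ∑ ij ∈ I, P.real (E ij) := measureReal_biUnion_finset_le _ _
  obtain ⟨⟨i, j⟩, hij, hle⟩ := Finset.exists_le_of_sum_le (by rw [← Finset.card_pos, hcard]; norm_num) hsum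
  rw [hI, Finset.mem_product, Finset.mem_range, Finset.mem_Icc] at hij
  obtain ⟨hi, hj5, hj12⟩ := hij
  -- the chosen pair, inside the box with top row `13n`
  have hle' : c / 32 ≤ P.real (slabConn k (boxR (-(7 * n)) (7 * n) 0 (13 * n))
      (sideSeg (7 * n) (i * n) (i * n + n - 1)) (sideSeg (7 * n) (j * n) (j * n + n - 1))) := by
    refine hle.trans (measureReal_mono (slabConn_mono_domain fun z hz => ?_))
    rw [mem_boxR_iff] at hz ⊢; omega
  have h1 := case1_lr hk hρ hn p hp0 hp1 (c₁ := c / 32) (by positivity) (i := i) (j := j) (by omega) hj5 hj12 hle'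
  rw [← hΛ] at h1
  refine le_trans ?_ h1
  -- monotonicity in the exponent: `32 - j ≤ 27` and `(c/32)/Λ ≤ 1`
  have hc1 : c ≤ 1 := h.trans measureReal_le_one
  have hx1 : c / 32 / Λ ≤ 1 := by
    rw [div_le_one (by positivity)]
    linarith
  exact mul_le_mul_of_nonneg_left (pow_le_pow_of_le_one (by positivity) hx1 (by omega)) (by positivity)

end NTW17

end Literature.Probability.Percolation
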